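import Summits.Ventures.PackingBounds.Energy.FivePointRieszSixGramDataY
import Summits.Ventures.PackingBounds.Energy.FivePointRieszSixGramDataL
import Summits.Ventures.PackingBounds.Energy.FivePointRieszSixGramDataE
import Summits.Ventures.PackingBounds.Energy.GramDataCheck
import HarnessLib

/-!
# The 158 × 158 SOS Gram block of `e3pt-sharp-n3N5s6d8-none.json`: integer PSD checks, row chunks file 7/10 (kernel evaluation)

Framing: lottery ticket; floor = certified bounds/negative ranges. Venture `PackingBounds`, cell
`pub-packcert`, energy family E3PT (pub-packcert-energy gen 15; n = 3, d = 8 kernel route = KERNEL-D6 double data route, size-split).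

`decide +kernel` checks, in row chunks, the integer identity `S·Y = L Lᵀ + E` with `E` symmetric (`GramData.checkRows`) for the data tables
`FivePointRieszSixGramDataY/L/E`; collected with the diagonal dominance of `E` in `FivePointRieszSixGramFacts`.
-/

namespace Summit.Ventures.PackingBounds.Energy.RieszSixD8

open Summit.Ventures.PackingBounds.Energy.GramData

set_option maxRecDepth 100000 in
/-- Rows 96–103 of `S·Y = L Lᵀ + E`, `E` symmetric (kernel evaluation). -/
theorem rowsR6_96_104 : checkRows 158 158 96 104 yR6 lR6 eR6 = true := by decide +kernel

set_option maxRecDepth 100000 in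
/-- Rows 104–111 of `S·Y = L Lᵀ + E`, `E` symmetric (kernel evaluation). -/
theorem rowsR6_104_112 : checkRows 158 158 104 112 yR6 lR6 eR6 = true := by decide +kernel

end Summit.Ventures.PackingBounds.Energy.RieszSixD8
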